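import Literature.AlgebraicGeometry.HodgeTheory.HodgeLociCountableOverCurves
import Literature.AlgebraicGeometry.HodgeTheory.HypersurfaceFamilyTopFormFramesChart
import Literature.AlgebraicGeometry.Motives.SpecialisedHypersurfaceFamilyFibreImmersion
import Literature.AlgebraicGeometry.HodgeTheory.BettiUniverseAxioms
import HarnessLib

/-!
# All but COUNTABLY many members of a one-parameter polynomial family of smooth surfaces in `ℙ³` are
# Hodge generic for the family (Deligne 1972 Prop. 7.5 over a curve) — no Cattani–Deligne–Kaplan

Family `hodge`, layer `Literature/AlgebraicGeometry/HodgeTheory`. Theorems only (no definition, no named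
fact). Written by the prover seat `hodge-nonav-prover-Ax` (g13, cell `hodge-nonav`), programme «AE»
(route `HodgeConjecture/CyclicUnitaryPowers`, `--supports stmt-HodgeConjecture-19544`).

For the specialised families of smooth surfaces of degree `d ≥ 4` in `ℙ³` over a ONE-dimensional
polynomial base — `familySpz ℂ 2 d sp : 𝒴_sp ⟶ S_sp`, `sp : CoeffRing ℂ 2 d →ₐ ℂ[u]` a specialisation of the
coefficients to polynomials in ONE variable (`σ = Fin 1`), `S_sp ⊆ 𝔸¹` the open set of parameters with
nonsingular form (Voisin II §6.2.1) — Griffiths' holomorphic frames of `F²H²` are tree theorems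
(`exists_topFormFrame_familySpz_chartAt`: periods of relative residues), so the CDK-free bookkeeping of
`HodgeLociCountableOverCurves` applies: the set of points of `S_sp(ℂ)` which are NOT Hodge generic
(`IsHodgeGenericPoint`: every weight-`0` rational Hodge tensor of `H²` of the fibre stays Hodge under every
rational transport ALONG THE PENCIL) is COUNTABLE.

* `countable_setOf_not_isHodgeGenericPoint_surfacePencil`, `exists_countable_isHodgeGenericPoint_surfacePencil`.

Honest scope: Hodge-genericity here refers to the transports of the one-parameter family itself (its own
monodromy), which is what Deligne's lemma (`deligne_finiteIndex_monodromy_le_mumfordTateGroup_of_isQuasiProjectiveOver`)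
consumes for THAT family; turning it into statements about Hodge groups needs the pencil's monodromy to
be large (a Lefschetz/Zariski-type input), not supplied here. Nothing in this file says HC or any rung is
proved.

## References

* [Deligne1972WeilK3] P. Deligne, La conjecture de Weil pour les surfaces K3, Invent. Math. 15 (1972),
  Prop. 7.5.
* [VoisinHodgeII2003] C. Voisin, Hodge Theory and Complex Algebraic Geometry II (2003), §5.3.1
  Lemma 5.13, §6.1.3, §6.2.1.
* [Griffiths1968PeriodsII] P. Griffiths, Periods of integrals on algebraic manifolds II, Amer. J. Math.
  90 (1968), Thm. 1.1.
* [FritzscheGrauert2002] K. Fritzsche, H. Grauert, From Holomorphic Functions to Complex Manifolds,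
  GTM 213 (2002), Ch. I §8.
-/

noncomputable section

open CategoryTheory AlgebraicGeometry
open _root_.Topology _root_.Filter
open scoped TensorProduct
open Literature.AlgebraicTopology.SingularHomology
open Literature.AlgebraicGeometry.Motives Literature.AlgebraicGeometry.Motives.UniversalHypersurface
open Literature.AlgebraicGeometry.HodgeTheory.UniversalHypersurface

namespace Literature.AlgebraicGeometry.HodgeTheory

section HodgeTheory

variable (d : ℕ) (sp : CoeffRing ℂ 2 d →ₐ[ℂ] MvPolynomial (Fin 1) ℂ)

/-- The base `S_sp ⊆ 𝔸¹` of a one-parameter specialised family is smooth of relative dimension `1`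
(`smoothOfRelativeDimension_baseSpz_hom` with `Nat.card (Fin 1) = 1`). [cite: VoisinHodgeII2003, §6.2.1] -/
theorem smoothOfRelativeDimension_one_baseSpz_hom :
    AlgebraicGeometry.SmoothOfRelativeDimension 1 (baseSpz ℂ 2 d sp).hom := by
  have h := smoothOfRelativeDimension_baseSpz_hom ℂ 2 d sp
  rwa [Nat.card_eq_fintype_card, Fintype.card_fin] at h

/-- **Over a one-parameter polynomial family of smooth surfaces of degree `d ≥ 4` in `ℙ³`, the
non-Hodge-generic parameters form a COUNTABLE set** (Deligne 1972 Prop. 7.5 on a curve; Griffiths'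
frames by relative residues; zeros of one-variable holomorphic functions are countable): for every family
of Hodge-symmetric fibre models `A`, `{t ∈ S_sp(ℂ) | ¬ IsHodgeGenericPoint (familySpz ℂ 2 d sp) 2 … t}` is
countable. No Cattani–Deligne–Kaplan. [cite: Deligne1972WeilK3, Prop. 7.5]
[cite: VoisinHodgeII2003, §5.3.1 Lemma 5.13 and §6.2.1] [cite: Griffiths1968PeriodsII, Thm. 1.1]
[cite: FritzscheGrauert2002, Chapter I §8] -/
theorem countable_setOf_not_isHodgeGenericPoint_surfacePencil [HodgeTensorFacts.{0, 0}] (hd : 4 ≤ d)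
    (A : ∀ t : ComplexPoints (baseSpz ℂ 2 d sp), HodgeModel 2 (fiberOver (familySpz ℂ 2 d sp) t))
    (hA : ∀ t, (A t).IsHodgeSymmetric) :
    haveI : ∀ t : ComplexPoints (baseSpz ℂ 2 d sp),
        Module.Finite ℚ (singularCohomology ℚ ℚ (ComplexPoints (fiberOver (familySpz ℂ 2 d sp) t)) 2) :=
      fun t => BettiUniverse.finite ((isSmoothProjectiveFamily_familySpz ℂ 2 d sp (by norm_num)
        (by omega)).isSmoothProjective t) 2
    {t : (Set.univ : Set (ComplexPoints (baseSpz ℂ 2 d sp))) |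
      ¬ IsHodgeGenericPoint (familySpz ℂ 2 d sp) 2
        (isCohomologicallyLocallyTrivialOn_familySpz 2 d sp (by norm_num) (by omega))
        (isSmoothProjectiveFamily_familySpz ℂ 2 d sp (by norm_num) (by omega)) A hA t}.Countable := by
  haveI : ∀ t : ComplexPoints (baseSpz ℂ 2 d sp),
      Module.Finite ℚ (singularCohomology ℚ ℚ (ComplexPoints (fiberOver (familySpz ℂ 2 d sp) t)) 2) :=
    fun t => BettiUniverse.finite ((isSmoothProjectiveFamily_familySpz ℂ 2 d sp (by norm_num)
      (by omega)).isSmoothProjective t) 2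
  haveI := smoothOfRelativeDimension_one_baseSpz_hom d sp
  haveI : LocallyOfFiniteType (baseSpz ℂ 2 d sp).hom := locallyOfFiniteType_baseSpz_hom ℂ 2 d sp
  refine countable_setOf_not_isHodgeGenericPoint_of_weightTwoFrames_curve (familySpz ℂ 2 d sp)
    (isSmoothProjectiveFamily_familySpz ℂ 2 d sp (by norm_num) (by omega)) (isQuasiProjectiveOver_baseSpz 2 d sp)
    (isCohomologicallyLocallyTrivialOn_familySpz 2 d sp (by norm_num) (by omega)) A hA
    (show 1 ≤ 2 + 1 by norm_num) (totalSpzToTotal ℂ 2 d sp ≫ toProjectiveSpace ℂ 2 d)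
    (isClosedImmersion_fiberι_familySpz_toProjectiveSpace ℂ 2 d sp) (fun _ ↦ True)
    fun s t₁ N hN T₁ _ ↦ ?_
  obtain ⟨W₀, hW₀o, ht₁W₀, hW₀N, hW₀pc, ψ, -, hW₀ψ, r₂, w₂, hw₂, hhol⟩ :=
    exists_topFormFrame_familySpz_chartAt 1 d sp (by omega) 1
      (isSmoothProjectiveFamily_familySpz ℂ 2 d sp (by norm_num) (by omega))
      (isCohomologicallyLocallyTrivialOn_familySpz 2 d sp (by norm_num) (by omega)) A hA s t₁ N hN T₁
  exact ⟨W₀, hW₀o, ht₁W₀, hW₀N, hW₀pc, ψ, trivial, hW₀ψ, r₂, w₂, hw₂, hhol⟩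

/-- **Consumer form**: a COUNTABLE set `C ⊆ S_sp(ℂ)` of parameters off which every member of the
one-parameter family of surfaces is Hodge generic for the family. [cite: Deligne1972WeilK3, Prop. 7.5]
[cite: VoisinHodgeII2003, §5.3.1 Lemma 5.13 and §6.2.1] -/
theorem exists_countable_isHodgeGenericPoint_surfacePencil [HodgeTensorFacts.{0, 0}] (hd : 4 ≤ d)
    (A : ∀ t : ComplexPoints (baseSpz ℂ 2 d sp), HodgeModel 2 (fiberOver (familySpz ℂ 2 d sp) t))
    (hA : ∀ t, (A t).IsHodgeSymmetric) :
    haveI : ∀ t : ComplexPoints (baseSpz ℂ 2 d sp),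
        Module.Finite ℚ (singularCohomology ℚ ℚ (ComplexPoints (fiberOver (familySpz ℂ 2 d sp) t)) 2) :=
      fun t => BettiUniverse.finite ((isSmoothProjectiveFamily_familySpz ℂ 2 d sp (by norm_num)
        (by omega)).isSmoothProjective t) 2
    ∃ C : Set (ComplexPoints (baseSpz ℂ 2 d sp)), C.Countable ∧
      ∀ s : (Set.univ : Set (ComplexPoints (baseSpz ℂ 2 d sp))), s.1 ∉ C →
        IsHodgeGenericPoint (familySpz ℂ 2 d sp) 2
          (isCohomologicallyLocallyTrivialOn_familySpz 2 d sp (by norm_num) (by omega))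
          (isSmoothProjectiveFamily_familySpz ℂ 2 d sp (by norm_num) (by omega)) A hA s := by
  haveI : ∀ t : ComplexPoints (baseSpz ℂ 2 d sp),
      Module.Finite ℚ (singularCohomology ℚ ℚ (ComplexPoints (fiberOver (familySpz ℂ 2 d sp) t)) 2) :=
    fun t => BettiUniverse.finite ((isSmoothProjectiveFamily_familySpz ℂ 2 d sp (by norm_num)
      (by omega)).isSmoothProjective t) 2
  refine ⟨Subtype.val '' {t : (Set.univ : Set (ComplexPoints (baseSpz ℂ 2 d sp))) |
      ¬ IsHodgeGenericPoint (familySpz ℂ 2 d sp) 2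
        (isCohomologicallyLocallyTrivialOn_familySpz 2 d sp (by norm_num) (by omega))
        (isSmoothProjectiveFamily_familySpz ℂ 2 d sp (by norm_num) (by omega)) A hA t},
    (countable_setOf_not_isHodgeGenericPoint_surfacePencil d sp hd A hA).image _, fun s hs ↦ ?_⟩
  by_contra h
  exact hs ⟨s, h, rfl⟩

end HodgeTheory

end Literature.AlgebraicGeometry.HodgeTheory

end
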